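import Summits.KontsevichZagierPeriods.Zeta5Search.Certificates.TwoTaleOmegaAefTable
import Summits.KontsevichZagierPeriods.Zeta5Search.Certificates.TwoTaleOmegaCoverage

/-!
# ζ(2) two-tale line — the RULE legitimacy predicate and the shape of the BASE (cell `pub-zeta5`, certifier `cert-2`)

HONEST FRAMING: systematic search; recurrence certificates; no irrationality claim unless certified.

fam-tele gen 3, `certs/tele/bmiss_general/PROOF.md` §1/§5: `RULE(p)` = the FIRST applicable direction in the order `g, b, e, f, a, aef, bg`;
a step is used iff it is the rule AND certified ((S2), here an abstract predicate `Cert δ` on base points); BASE = un-ruled points ∪ EXC.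
This file instantiates the legitimacy predicate of `TwoTaleOmegaAefTable.eq_on_Omega_all` accordingly (`RuleDom δ` = targets whose rule
is `δ`; `LegitSet Cert δ` = base points of rule-`δ` steps that are certified, with `a ≥ 17` at the target for `δ ∈ {a, aef}` — the range
where the tree's (S3) for these directions applies) and proves: `eq_on_Omega_rule` — (bmiss)-type equality on `Ω` from the analytic step
relations for such steps and equality on `Base`; and `base_cases` — a point of that `Base` lies in the finite BOX
`3 ≤ a ≤ 16, b ≤ 2a+7, e,f ≤ a, g ≤ 5a+6` or is the target of an UNCERTIFIED rule step (fam-tele's EXC when `Cert` := the (S2) verdict).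
Linear arithmetic only; nothing analytic is proved here.
-/

namespace Summit.KontsevichZagierPeriods.Zeta5Search.Certificates

namespace TwoTaleTelescope

open Finset

/-- `RuleDom δ`: the targets `p` whose RULE is `δ` (first applicable direction in the order g, b, e, f, a, aef, bg). -/
def RuleDom (δ : Pt) : Set Pt :=
  if δ = dirG then App dirG
  else if δ = dirB then {p | p ∈ App dirB ∧ p ∉ App dirG}
  else if δ = dirE then {p | p ∈ App dirE ∧ p ∉ App dirG ∧ p ∉ App dirB}
  else if δ = dirF then {p | p ∈ App dirF ∧ p ∉ App dirG ∧ p ∉ App dirB ∧ p ∉ App dirE}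
  else if δ = dirA then {p | p ∈ App dirA ∧ p ∉ App dirG ∧ p ∉ App dirB ∧ p ∉ App dirE ∧ p ∉ App dirF}
  else if δ = dirAEF then {p | p ∈ App dirAEF ∧ p ∉ App dirG ∧ p ∉ App dirB ∧ p ∉ App dirE ∧ p ∉ App dirF ∧ p ∉ App dirA}
  else if δ = dirBG then
    {p | p ∈ App dirBG ∧ p ∉ App dirG ∧ p ∉ App dirB ∧ p ∉ App dirE ∧ p ∉ App dirF ∧ p ∉ App dirA ∧ p ∉ App dirAEF}
  else ∅

/-- The two distinctness facts in the orientation `RuleDom` needs beyond `dir_ne`. -/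
theorem dir_ne' : dirBG ≠ dirA ∧ dirBG ≠ dirAEF := by
  refine ⟨?_, ?_⟩ <;>
  · intro h
    have h0 := congrFun h 0; have h1 := congrFun h 1
    simp [dirA, dirAEF, dirBG] at h0 h1

/-- `RuleDom` on `g`. -/
theorem ruleDom_G : RuleDom dirG = App dirG := by simp [RuleDom]
/-- `RuleDom` on `b`. -/
theorem ruleDom_B : RuleDom dirB = {p | p ∈ App dirB ∧ p ∉ App dirG} := by simp [RuleDom, dir_ne]
/-- `RuleDom` on `e`. -/
theorem ruleDom_E : RuleDom dirE = {p | p ∈ App dirE ∧ p ∉ App dirG ∧ p ∉ App dirB} := by simp [RuleDom, dir_ne]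
/-- `RuleDom` on `f`. -/
theorem ruleDom_F : RuleDom dirF = {p | p ∈ App dirF ∧ p ∉ App dirG ∧ p ∉ App dirB ∧ p ∉ App dirE} := by simp [RuleDom, dir_ne]
/-- `RuleDom` on `a`. -/
theorem ruleDom_A : RuleDom dirA = {p | p ∈ App dirA ∧ p ∉ App dirG ∧ p ∉ App dirB ∧ p ∉ App dirE ∧ p ∉ App dirF} := by
  simp [RuleDom, dir_ne]
/-- `RuleDom` on `aef`. -/
theorem ruleDom_AEF : RuleDom dirAEF =
    {p | p ∈ App dirAEF ∧ p ∉ App dirG ∧ p ∉ App dirB ∧ p ∉ App dirE ∧ p ∉ App dirF ∧ p ∉ App dirA} := by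
  simp [RuleDom, dir_ne]
/-- `RuleDom` on `bg`. -/
theorem ruleDom_BG : RuleDom dirBG =
    {p | p ∈ App dirBG ∧ p ∉ App dirG ∧ p ∉ App dirB ∧ p ∉ App dirE ∧ p ∉ App dirF ∧ p ∉ App dirA ∧ p ∉ App dirAEF} := by
  simp [RuleDom, dir_ne, dir_ne']

/-- A rule target is applicable for its rule. -/
theorem app_of_ruleDom {δ p : Pt} (hδ : δ ∈ dirs) (h : p ∈ RuleDom δ) : p ∈ App δ := by
  simp only [dirs, List.mem_cons, List.mem_nil_iff, or_false] at hδ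
  rcases hδ with rfl | rfl | rfl | rfl | rfl | rfl | rfl
  · rwa [ruleDom_G] at h
  · rw [ruleDom_B] at h; exact h.1
  · rw [ruleDom_E] at h; exact h.1
  · rw [ruleDom_F] at h; exact h.1
  · rw [ruleDom_A] at h; exact h.1
  · rw [ruleDom_AEF] at h; exact h.1
  · rw [ruleDom_BG] at h; exact h.1

/-- If some direction is applicable at `p`, then `p` has a rule. -/
theorem exists_ruleDom {p : Pt} (h : ∃ δ ∈ dirs, p ∈ App δ) : ∃ δ ∈ dirs, p ∈ RuleDom δ := by
  by_cases hG : p ∈ App dirG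
  · exact ⟨dirG, by simp [dirs], by rwa [ruleDom_G]⟩
  by_cases hB : p ∈ App dirB
  · exact ⟨dirB, by simp [dirs], by rw [ruleDom_B]; exact ⟨hB, hG⟩⟩
  by_cases hE : p ∈ App dirE
  · exact ⟨dirE, by simp [dirs], by rw [ruleDom_E]; exact ⟨hE, hG, hB⟩⟩
  by_cases hF : p ∈ App dirF
  · exact ⟨dirF, by simp [dirs], by rw [ruleDom_F]; exact ⟨hF, hG, hB, hE⟩⟩
  by_cases hA : p ∈ App dirA
  · exact ⟨dirA, by simp [dirs], by rw [ruleDom_A]; exact ⟨hA, hG, hB, hE, hF⟩⟩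
  by_cases hAEF : p ∈ App dirAEF
  · exact ⟨dirAEF, by simp [dirs], by rw [ruleDom_AEF]; exact ⟨hAEF, hG, hB, hE, hF, hA⟩⟩
  by_cases hBG : p ∈ App dirBG
  · exact ⟨dirBG, by simp [dirs], by rw [ruleDom_BG]; exact ⟨hBG, hG, hB, hE, hF, hA, hAEF⟩⟩
  obtain ⟨δ, hδ, happ⟩ := h
  simp only [dirs, List.mem_cons, List.mem_nil_iff, or_false] at hδ
  rcases hδ with rfl | rfl | rfl | rfl | rfl | rfl | rfl <;> contradiction

/-- LEMMA C1 sharpened: for `b ≥ 2a+8` the rule is never `a` … -/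
theorem not_ruleA_large_b (p : Pt) (hp : p ∈ Omega) (hb : 2 * p 0 + 8 ≤ p 1) (hA : p ∈ App dirA) (hg : p ∉ App dirG)
    (hbb : p ∉ App dirB) : False := by
  have h1 := not_app_G p hp hg
  have h2 := not_app_B p hp hbb
  have h3 := hA 3 le_rfl
  rw [mem_Omega] at hp h3
  obtain ⟨e0, e1, e2, e3, e4⟩ := shift_A p ((3 : ℕ) : ℤ)
  rw [e0, e1, e2, e3, e4] at h3
  push_cast at h3
  omega

/-- … nor `aef`. -/
theorem not_ruleAEF_large_b (p : Pt) (hp : p ∈ Omega) (hb : 2 * p 0 + 8 ≤ p 1) (hA : p ∈ App dirAEF) (hg : p ∉ App dirG)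
    (hbb : p ∉ App dirB) : False := by
  have h1 := not_app_G p hp hg
  have h2 := not_app_B p hp hbb
  have h3 := hA 3 le_rfl
  rw [mem_Omega] at hp h3
  obtain ⟨e0, e1, e2, e3, e4⟩ := shift_AEF p ((3 : ℕ) : ℤ)
  rw [e0, e1, e2, e3, e4] at h3
  push_cast at h3
  omega

/-- The RULE legitimacy sets: base points `p₀` of direction-`δ` steps whose target `p₀ + 3δ` has rule `δ`, which are certified
(`Cert δ`, abstract — PROOF.md (S2)), and, for `δ ∈ {a, aef}`, whose target has `a ≥ 17` (where the tree's (S3) for these directions applies). -/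
def LegitSet (Cert : Pt → Set Pt) (δ : Pt) : Set Pt :=
  {p₀ | p₀ + (3 : ℤ) • δ ∈ RuleDom δ ∧ p₀ ∈ Cert δ ∧ ((δ = dirA ∨ δ = dirAEF) → 17 ≤ (p₀ + (3 : ℤ) • δ) 0)}

/-- **(bmiss)-type equality on `Ω` from RULE steps.**  With the legitimacy predicate `LegitSet Cert`: if `I_L = I_R` on the corresponding
`Base` and both functions satisfy the analytic step relations (tree coefficients `coef cAEFtab`) for every certified rule step, then
`I_L = I_R` on `Ω`.  All of (S1)'s operators, (S3), the induction and the rule analysis are kernel theorems behind this statement. -/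
theorem eq_on_Omega_rule {F : Type*} [Field F] [CharZero F] (Cert : Pt → Set Pt) (IL IR : Pt → F)
    (hbase : ∀ p ∈ Base (fun δ p₀ => p₀ ∈ LegitSet Cert δ), IL p = IR p)
    (hL : ∀ δ, ∀ p₀ ∈ StepBase (fun δ p₀ => p₀ ∈ LegitSet Cert δ) δ,
      ∑ k ∈ range 4, (coef cAEFtab δ p₀ k : F) * IL (p₀ + (k : ℤ) • δ) = 0)
    (hR : ∀ δ, ∀ p₀ ∈ StepBase (fun δ p₀ => p₀ ∈ LegitSet Cert δ) δ,
      ∑ k ∈ range 4, (coef cAEFtab δ p₀ k : F) * IR (p₀ + (k : ℤ) • δ) = 0) :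
    ∀ p ∈ Omega, IL p = IR p := by
  refine eq_on_Omega_all _ IL IR (fun p₀ h => ?_) (fun p₀ h => ?_) hbase hL hR
  · obtain ⟨hr, -, h17⟩ := h
    rw [ruleDom_A] at hr
    obtain ⟨-, hg, hb, -, -⟩ := hr
    have := h17 (Or.inl rfl)
    have e0 : (p₀ + (3 : ℤ) • dirA) 0 = p₀ 0 + 3 := by simp [dirA]
    exact ⟨by omega, hg, hb⟩
  · obtain ⟨hr, -, h17⟩ := h
    rw [ruleDom_AEF] at hr
    obtain ⟨-, hg, hb, he, hf, ha⟩ := hr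
    exact ⟨h17 (Or.inr rfl), hg, hb, he, hf, ha⟩

/-- The finite BOX of PROOF.md §5 (`no_rule_box`). -/
def Box : Set Pt := {p | 3 ≤ p 0 ∧ p 0 ≤ 16 ∧ p 1 ≤ 2 * p 0 + 7 ∧ p 2 ≤ p 0 ∧ p 3 ≤ p 0 ∧ p 4 ≤ 5 * p 0 + 6}

/-- **Shape of the BASE** for the rule legitimacy predicate: a base point is in `Ω` and either lies in the finite `Box`, or is the target of
its rule step whose base point is NOT certified (fam-tele's EXC list when `Cert` is the (S2) verdict). -/
theorem base_cases (Cert : Pt → Set Pt) (p : Pt) (h : p ∈ Base (fun δ p₀ => p₀ ∈ LegitSet Cert δ)) :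
    p ∈ Omega ∧ (p ∈ Box ∨ ∃ δ ∈ dirs, p ∈ RuleDom δ ∧ p - (3 : ℤ) • δ ∉ Cert δ) := by
  obtain ⟨hp, hno⟩ := h
  refine ⟨hp, ?_⟩
  by_cases hrule : ∃ δ ∈ dirs, p ∈ RuleDom δ
  · obtain ⟨δ, hδ, hr⟩ := hrule
    by_cases hc : p - (3 : ℤ) • δ ∈ Cert δ
    · -- certified rule step: it is NOT a StepBase step only if δ ∈ {a, aef} with a ≤ 16 — then `p ∈ Box`
      left
      have happ : p ∈ App δ := app_of_ruleDom hδ hr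
      have hst : ¬ (p - (3 : ℤ) • δ ∈ StepBase (fun δ p₀ => p₀ ∈ LegitSet Cert δ) δ) := hno δ hδ
      have h16 : (δ = dirA ∨ δ = dirAEF) ∧ p 0 ≤ 16 := by
        by_contra hcon
        apply hst
        refine ⟨hδ, ((mem_App_iff_stepBase δ hδ p).mp happ).2.1, ?_⟩
        refine ⟨by rw [sub_add_cancel]; exact hr, hc, fun hd => ?_⟩
        rw [sub_add_cancel]
        by_contra h17
        exact hcon ⟨hd, by omega⟩
      obtain ⟨hd, ha16⟩ := h16
      have h3 := three_le_a p hp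
      have hb : p 1 ≤ 2 * p 0 + 7 := by
        by_contra hb'
        rcases hd with rfl | rfl
        · rw [ruleDom_A] at hr; exact not_ruleA_large_b p hp (by omega) hr.1 hr.2.1 hr.2.2.1
        · rw [ruleDom_AEF] at hr; exact not_ruleAEF_large_b p hp (by omega) hr.1 hr.2.1 hr.2.2.1
      rw [mem_Omega] at hp
      simp only [Box, Set.mem_setOf_eq]
      omega
    · exact Or.inr ⟨δ, hδ, hr, hc⟩
  · -- no rule: no direction applicable, hence in the box
    left
    have hnone : ∀ δ ∈ dirs, p ∉ App δ := fun δ hδ happ => hrule (exists_ruleDom ⟨δ, hδ, happ⟩)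
    have := no_rule_box p hp hnone
    simp only [Box, Set.mem_setOf_eq]
    exact this

end TwoTaleTelescope

end Summit.KontsevichZagierPeriods.Zeta5Search.Certificates
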